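import Literature.Analysis.FluidPDE.LoopCirculation
import Literature.Analysis.FluidPDE.LocalBiotSavartCalculus

/-!
# Route `FilamentSkeletonRss` · crux `SelectionBoxRJ` (stmt-NavierStokesRegularity-21220) — TORQUE-FREE FLOWS:
# on an irrotational region the rotating-Leray profile operator of an incompressible field is an exact gradient,
# so it has zero circulation around EVERY closed loop there (including loops linking a vortex core)

Lane `ns-filament-19175-p1` (g10).  Helper file `--supports stmt-NavierStokesRegularity-21220 --as helper`; bears on the
whole J selection layer (`SelectionBoxRJ` 21220 / `TransverseReductionRJ` 21221 / asides 19174–19175).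

SOURCE OF THE STATEMENT.  F6 verdict memo of the crux-level line `rpi_window_split`
(`Cruxes/SelectionBoxRJ/Lines/rpi_window_split_v6_F6.md`, ns-idea-12 g2, 2026-08-28), §2 (TF), labelled EXACT there:
«for ANY smooth divergence-free `ũ` whose vorticity near `L` is transversally confined and whose far field near the wall is
irrotational, `profileOp_α(ũ)` is an exact gradient on the irrotational region:
`−Δ∇φ = ∇(−Δφ)`, `½(∇φ + (y·∇)∇φ) = ½∇(y·∇φ)`, `−αG∇φ = −α∇((e₃×y)·∇φ)`, `(ũ·∇)ũ = ∇(|ũ|²/2)` (`y·∇φ`, `(e₃×y)·∇φ`, `|∇φ|²`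
single-valued even though `φ` is not).  Hence `Circ[ũ](s,R) := ∮_{∂D_R(s)} profileOp_α(ũ)·dl = 0` for every circle outside
the core.»  This is what makes every slip / K-moment functional of the dead sign stubs see only in-core defects (memo §2–3).

WHAT IS KERNEL-CHECKED HERE.  The profile operator is written out VERBATIM in the crux's pointwise vocabulary,
`E_α(U)(y) = α • (cross e₃ (U y) − fderiv ℝ U y (cross e₃ y)) + ½ • U y + ½ • fderiv ℝ U y y − (Δ U) y + fderiv ℝ U y (U y)`
(`e₃ = EuclideanSpace.single 2 1`) — literally the body of `KelvinGate.lerayOp α U y` of `…Theorems/FilamentSkeletonRssKelvinGateDefs`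
(so every statement below rewrites to that name by `rfl`); the definition is not imported, to keep this file outside the
theses cone (route-independent, like the lineage's other census files).
ROUTE-INDEPENDENT CONTENT:
* `inner_cross_left_swap` — the triple-product antisymmetry `⟪a × b, c⟫ = −⟪a × c, b⟫`;
* `inner_fderiv_comm_of_curl_eq_zero` — IRROTATIONAL AT A POINT ⇒ SYMMETRIC JACOBIAN: `curl U (y) = 0` gives
  `⟪a, DU(y) b⟫ = ⟪DU(y) a, b⟫` (from the tree's `inner_curl_cross`);
* `hasGradientAt_inner_self` / `hasGradientAt_inner_cross` / `hasGradientAt_half_norm_sq` — with a symmetric Jacobian the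
  three transport terms are gradients of SINGLE-VALUED functions of `U` itself (no potential needed):
  `∇⟪y, U⟫ = U + DU[y]`, `∇⟪e × y, U⟫ = DU[e × y] − e × U`, `∇(½|U|²) = DU[U]`;
* `hasGradientAt_transportPotential` — hence the whole transport part of `E_α` is `∇Φ_U` with
  `Φ_U(z) = ½⟪z, U z⟫ − α⟪e₃ × z, U z⟫ + ½|U z|²` at every point where `U` is differentiable with `curl U = 0`;
* `laplacian_eq_zero_of_curl_eventuallyEq_zero` — a `C²` divergence-free field irrotational NEAR `y` is harmonic at `y`
  (`ΔU = −curl curl U`, tree `laplacian_eq_neg_curl_curl`);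
* `lerayOp_eq_gradient_of_irrotational` — **(TF), pointwise**: `E_α(U)(y) = ∇Φ_U(y)` for `U ∈ C²` divergence-free and
  irrotational near `y`;
* `circulation_gradient_eq_sub` / `circulation_gradient_loop_eq_zero` — the gradient theorem for the tree's `circulation`
  (`∮_γ ∇Φ·dl = Φ(γ 1) − Φ(γ 0)`, `= 0` on a closed `C¹` loop);
* `contDiff_lerayOp` — `U ∈ C³ ⇒ E_α(U) ∈ C¹`; `integral_curl_lerayOp_disc_eq_zero` — the disc-flux (Stokes) reading;
* `circulation_lerayOp_eq_zero_of_irrotational` / `…_circleLoop_…` — **(TF), integrated**: for `U ∈ C²(ℝ³)` divergence-free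
  with `curl U = 0` on an open set `Ω`, `∮_γ E_α(U)·dl = 0` for every closed `C¹` loop `γ ⊂ Ω` — in particular for the wall
  circles `∂D_R(s)` of the torque budget, and ALSO for loops that link a vortex tube (Ω need not be simply connected: `Φ_U`
  is single-valued), which is the point of the memo's remark.
Scope: the divergence-free case (the fields of the route); for a general irrotational `C²` field the viscous term
contributes the extra gradient `−∇(div U)`, not treated here.  Global `C²` + global `div U = 0` + LOCAL `curl U = 0` is
exactly the situation of a Biot–Savart field of a compactly supported smooth vorticity seen outside its support.

HONEST FRAMING.  Elementary vector calculus about the profile operator of a HYPOTHETICAL filament-type rotating Leray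
profile (refutation-side bookkeeping of the route); nothing here bears on Navier–Stokes regularity or blow-up, and no
summit statement is proved by this file.
-/

set_option linter.dupNamespace false

noncomputable section

namespace Summit.NavierStokesRegularity.NavierStokesRegularity.Theorems

open Set Function Filter Real MeasureTheory
open Literature.Analysis.FluidPDE
open scoped InnerProductSpace Topology
open Laplacian

namespace TorqueBudget

/-! ### Algebra: the triple product and the symmetric Jacobian of an irrotational field -/

/-- Triple-product antisymmetry in the last two slots: `⟪a × b, c⟫ = −⟪a × c, b⟫`. [folklore] -/
theorem inner_cross_left_swap (a b c : EuclideanSpace ℝ (Fin 3)) : ⟪cross a b, c⟫_ℝ = -⟪cross a c, b⟫_ℝ := by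
  simp [cross, crossProduct, PiLp.inner_apply, Fin.sum_univ_three]
  ring

/-- **Irrotational at a point ⇒ symmetric Jacobian**: if `curl U (y) = 0` then `⟪a, DU(y) b⟫ = ⟪DU(y) a, b⟫` for all
`a, b` (the vorticity is the antisymmetric part of the velocity gradient, tree `inner_curl_cross`). [folklore] -/
theorem inner_fderiv_comm_of_curl_eq_zero {U : EuclideanSpace ℝ (Fin 3) → EuclideanSpace ℝ (Fin 3)} {y : EuclideanSpace ℝ (Fin 3)} (h : curl U y = 0) (a b : EuclideanSpace ℝ (Fin 3)) :
    ⟪a, fderiv ℝ U y b⟫_ℝ = ⟪fderiv ℝ U y a, b⟫_ℝ := by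
  have h1 := inner_curl_cross U y a b
  rw [h, inner_zero_left] at h1
  rw [← real_inner_comm a (fderiv ℝ U y b)]
  linarith

/-- From a Fréchet derivative whose value on every vector is an inner product with a fixed vector `g`, read off the
gradient: `HasGradientAt f g y`. [folklore] -/
theorem hasGradientAt_of_hasFDerivAt_inner {f : EuclideanSpace ℝ (Fin 3) → ℝ} {f' : EuclideanSpace ℝ (Fin 3) →L[ℝ] ℝ} {g y : EuclideanSpace ℝ (Fin 3)}
    (h : HasFDerivAt f f' y) (hg : ∀ v, f' v = ⟪g, v⟫_ℝ) : HasGradientAt f g y := by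
  rw [hasGradientAt_iff_hasFDerivAt]
  refine h.congr_fderiv ?_
  ext v
  rw [hg v, InnerProductSpace.toDual_apply_apply]

/-! ### The three transport terms are gradients of single-valued functions of `U` -/

/-- `∇⟪y, U(y)⟫ = U(y) + DU(y)[y]` when `DU(y)` is symmetric (the `½U + ½(y·∇)U` part of `E_α`). [folklore] -/
theorem hasGradientAt_inner_self {U : EuclideanSpace ℝ (Fin 3) → EuclideanSpace ℝ (Fin 3)} {U' : EuclideanSpace ℝ (Fin 3) →L[ℝ] EuclideanSpace ℝ (Fin 3)} {y : EuclideanSpace ℝ (Fin 3)} (hU : HasFDerivAt U U' y)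
    (hs : ∀ a b, ⟪a, U' b⟫_ℝ = ⟪U' a, b⟫_ℝ) :
    HasGradientAt (fun z : EuclideanSpace ℝ (Fin 3) => ⟪z, U z⟫_ℝ) (U y + U' y) y := by
  have h : HasFDerivAt (fun z : EuclideanSpace ℝ (Fin 3) => ⟪z, U z⟫_ℝ)
      ((fderivInnerCLM ℝ (id y, U y)).comp ((ContinuousLinearMap.id ℝ (EuclideanSpace ℝ (Fin 3))).prod U')) y :=
    (hasFDerivAt_id (𝕜 := ℝ) y).inner ℝ hU
  refine hasGradientAt_of_hasFDerivAt_inner h (fun v => ?_)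
  simp only [ContinuousLinearMap.comp_apply, ContinuousLinearMap.prod_apply, fderivInnerCLM_apply,
    ContinuousLinearMap.id_apply, id_eq]
  rw [inner_add_left, hs y v, ← real_inner_comm v (U y)]
  ring

/-- `∇⟪e × y, U(y)⟫ = DU(y)[e × y] − e × U(y)` when `DU(y)` is symmetric (the rotation part `α(e₃ × U − DU[e₃ × y])` of
`E_α` is `−α` times this gradient). [folklore] -/
theorem hasGradientAt_inner_cross {U : EuclideanSpace ℝ (Fin 3) → EuclideanSpace ℝ (Fin 3)} {U' : EuclideanSpace ℝ (Fin 3) →L[ℝ] EuclideanSpace ℝ (Fin 3)} {y : EuclideanSpace ℝ (Fin 3)} (e : EuclideanSpace ℝ (Fin 3)) (hU : HasFDerivAt U U' y)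
    (hs : ∀ a b, ⟪a, U' b⟫_ℝ = ⟪U' a, b⟫_ℝ) :
    HasGradientAt (fun z : EuclideanSpace ℝ (Fin 3) => ⟪cross e z, U z⟫_ℝ) (U' (cross e y) - cross e (U y)) y := by
  have h : HasFDerivAt (fun z : EuclideanSpace ℝ (Fin 3) => ⟪cross e z, U z⟫_ℝ)
      ((fderivInnerCLM ℝ (crossCLM e y, U y)).comp ((crossCLM e).prod U')) y :=
    (crossCLM e).hasFDerivAt.inner ℝ hU
  refine hasGradientAt_of_hasFDerivAt_inner h (fun v => ?_)
  simp only [ContinuousLinearMap.comp_apply, ContinuousLinearMap.prod_apply, fderivInnerCLM_apply,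
    crossCLM_apply]
  rw [inner_sub_left, hs (cross e y) v, inner_cross_left_swap e v (U y)]
  ring

/-- `∇(½|U|²)(y) = DU(y)[U(y)]` when `DU(y)` is symmetric (the Lamb form of the convective term for an irrotational
field). [folklore] -/
theorem hasGradientAt_half_norm_sq {U : EuclideanSpace ℝ (Fin 3) → EuclideanSpace ℝ (Fin 3)} {U' : EuclideanSpace ℝ (Fin 3) →L[ℝ] EuclideanSpace ℝ (Fin 3)} {y : EuclideanSpace ℝ (Fin 3)} (hU : HasFDerivAt U U' y)
    (hs : ∀ a b, ⟪a, U' b⟫_ℝ = ⟪U' a, b⟫_ℝ) :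
    HasGradientAt (fun z : EuclideanSpace ℝ (Fin 3) => (1 / 2 : ℝ) * ‖U z‖ ^ 2) (U' (U y)) y := by
  have h := hU.norm_sq.const_mul (1 / 2 : ℝ)
  refine hasGradientAt_of_hasFDerivAt_inner h (fun v => ?_)
  simp only [_root_.smul_apply, ContinuousLinearMap.comp_apply, innerSL_apply_apply, smul_eq_mul,
    nsmul_eq_mul, Nat.cast_ofNat]
  rw [hs (U y) v]
  ring

/-- **The transport part of `E_α` is a gradient at every irrotational point.**  If `U` has derivative `U'` at `y` with
`U'` symmetric, then `Φ_U(z) = ½⟪z, U z⟫ − α⟪e₃ × z, U z⟫ + ½|U z|²` has gradient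
`α(e₃ × U(y) − U'[e₃ × y]) + ½U(y) + ½U'[y] + U'[U(y)]` at `y`. [folklore] -/
theorem hasGradientAt_transportPotential (α : ℝ) {U : EuclideanSpace ℝ (Fin 3) → EuclideanSpace ℝ (Fin 3)} {U' : EuclideanSpace ℝ (Fin 3) →L[ℝ] EuclideanSpace ℝ (Fin 3)} {y : EuclideanSpace ℝ (Fin 3)}
    (hU : HasFDerivAt U U' y) (hs : ∀ a b, ⟪a, U' b⟫_ℝ = ⟪U' a, b⟫_ℝ) :
    HasGradientAt (fun z : EuclideanSpace ℝ (Fin 3) => (1 / 2 : ℝ) * ⟪z, U z⟫_ℝ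
        - α * ⟪cross (EuclideanSpace.single 2 1) z, U z⟫_ℝ + (1 / 2 : ℝ) * ‖U z‖ ^ 2)
      (α • (cross (EuclideanSpace.single 2 1) (U y) - U' (cross (EuclideanSpace.single 2 1) y))
        + (1 / 2 : ℝ) • U y + (1 / 2 : ℝ) • U' y + U' (U y)) y := by
  have h1 := hasGradientAt_iff_hasFDerivAt.mp (hasGradientAt_inner_self hU hs)
  have h2 := hasGradientAt_iff_hasFDerivAt.mp (hasGradientAt_inner_cross (EuclideanSpace.single 2 1) hU hs)
  have h3 := hasGradientAt_iff_hasFDerivAt.mp (hasGradientAt_half_norm_sq hU hs)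
  have h := ((h1.const_mul (1 / 2 : ℝ)).sub (h2.const_mul α)).add h3
  refine hasGradientAt_of_hasFDerivAt_inner h (fun v => ?_)
  simp only [_root_.add_apply, _root_.sub_apply, _root_.smul_apply,
    InnerProductSpace.toDual_apply_apply, smul_eq_mul, inner_add_left, inner_sub_left, real_inner_smul_left]
  ring

/-! ### The viscous term: a divergence-free field irrotational near `y` is harmonic at `y` -/

/-- `ΔU(y) = 0` for a `C²` divergence-free field on `EuclideanSpace ℝ (Fin 3)` whose curl vanishes on a neighbourhood of `y`
(`ΔU = −curl curl U`, and the curl of a field vanishing near `y` vanishes at `y`). [folklore] -/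
theorem laplacian_eq_zero_of_curl_eventuallyEq_zero {U : EuclideanSpace ℝ (Fin 3) → EuclideanSpace ℝ (Fin 3)} (hU : ContDiff ℝ 2 U)
    (hdiv : VectorCalculus.IsDivFree U) {y : EuclideanSpace ℝ (Fin 3)} (hcurl : ∀ᶠ z in 𝓝 y, curl U z = 0) :
    (Δ U) y = 0 := by
  rw [laplacian_eq_neg_curl_curl hU hdiv y]
  have h0 : curl U =ᶠ[𝓝 y] fun _ => (0 : EuclideanSpace ℝ (Fin 3)) := hcurl
  have h1 : fderiv ℝ (curl U) y = 0 := by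
    rw [h0.fderiv_eq]
    exact fderiv_const_apply 0
  simp [curl, h1]

/-! ### (TF), pointwise: `E_α(U) = ∇Φ_U` on the irrotational region -/

/-- **(TF), pointwise form** (F6 memo §2).  Let `U : EuclideanSpace ℝ (Fin 3) → EuclideanSpace ℝ (Fin 3)` be `C²` and divergence-free, and irrotational on a
neighbourhood of `y`.  Then the crux's profile operator is an exact gradient at `y`:
`E_α(U)(y) = ∇Φ_U(y)`, `Φ_U(z) = ½⟪z, U z⟫ − α⟪e₃ × z, U z⟫ + ½|U z|²` — a SINGLE-VALUED function of `U`. [folklore] -/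
theorem lerayOp_eq_gradient_of_irrotational (α : ℝ) {U : EuclideanSpace ℝ (Fin 3) → EuclideanSpace ℝ (Fin 3)} (hU : ContDiff ℝ 2 U)
    (hdiv : VectorCalculus.IsDivFree U) {y : EuclideanSpace ℝ (Fin 3)} (hcurl : ∀ᶠ z in 𝓝 y, curl U z = 0) :
    α • (cross (EuclideanSpace.single 2 1) (U y) - fderiv ℝ U y (cross (EuclideanSpace.single 2 1) y))
      + (1 / 2 : ℝ) • U y + (1 / 2 : ℝ) • fderiv ℝ U y y - (Δ U) y + fderiv ℝ U y (U y)
      = gradient (fun z : EuclideanSpace ℝ (Fin 3) => (1 / 2 : ℝ) * ⟪z, U z⟫_ℝ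
        - α * ⟪cross (EuclideanSpace.single 2 1) z, U z⟫_ℝ + (1 / 2 : ℝ) * ‖U z‖ ^ 2) y := by
  have hd : HasFDerivAt U (fderiv ℝ U y) y := (hU.differentiable two_ne_zero y).hasFDerivAt
  have hs : ∀ a b, ⟪a, fderiv ℝ U y b⟫_ℝ = ⟪fderiv ℝ U y a, b⟫_ℝ :=
    inner_fderiv_comm_of_curl_eq_zero hcurl.self_of_nhds
  rw [(hasGradientAt_transportPotential α hd hs).gradient,
    laplacian_eq_zero_of_curl_eventuallyEq_zero hU hdiv hcurl, sub_zero]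

/-! ### The gradient theorem for the tree's `circulation` -/

/-- The gradient field of a `C¹` function is continuous. [folklore] -/
theorem continuous_gradient_of_contDiff {Φ : EuclideanSpace ℝ (Fin 3) → ℝ} (hΦ : ContDiff ℝ 1 Φ) : Continuous (gradient Φ) :=
  (InnerProductSpace.toDual ℝ (EuclideanSpace ℝ (Fin 3))).symm.continuous.comp (hΦ.continuous_fderiv one_ne_zero)

/-- **Gradient theorem**: `∮_γ ∇Φ · dl = Φ(γ 1) − Φ(γ 0)` for `Φ ∈ C¹(EuclideanSpace ℝ (Fin 3))` and a `C¹` curve `γ` on `[0, 1]`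
(tree `circulation v γ = ∫₀¹ ⟪v(γ s), γ′ s⟫ ds`). [folklore] -/
theorem circulation_gradient_eq_sub {Φ : EuclideanSpace ℝ (Fin 3) → ℝ} (hΦ : ContDiff ℝ 1 Φ) {γ : ℝ → EuclideanSpace ℝ (Fin 3)} (hγ : ContDiff ℝ 1 γ) :
    circulation (gradient Φ) γ = Φ (γ 1) - Φ (γ 0) := by
  unfold circulation
  have hderiv : ∀ s, HasDerivAt (fun σ => Φ (γ σ)) (⟪gradient Φ (γ s), deriv γ s⟫_ℝ) s := by
    intro s
    have hγs : HasDerivAt γ (deriv γ s) s := (hγ.differentiable one_ne_zero s).hasDerivAt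
    have hΦs : HasFDerivAt Φ (fderiv ℝ Φ (γ s)) (γ s) := (hΦ.differentiable one_ne_zero (γ s)).hasFDerivAt
    have h := hΦs.comp_hasDerivAt s hγs
    rw [← inner_gradient_left] at h
    exact h
  have hint : IntervalIntegrable (fun s => ⟪gradient Φ (γ s), deriv γ s⟫_ℝ) volume 0 1 :=
    intervalIntegrable_inner_deriv (continuous_gradient_of_contDiff hΦ) hγ 0 1
  exact intervalIntegral.integral_eq_sub_of_hasDerivAt (fun s _ => hderiv s) hint

/-- A gradient field has zero circulation around every closed `C¹` loop. [folklore] -/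
theorem circulation_gradient_loop_eq_zero {Φ : EuclideanSpace ℝ (Fin 3) → ℝ} (hΦ : ContDiff ℝ 1 Φ) {γ : ℝ → EuclideanSpace ℝ (Fin 3)} (hγ : ContDiff ℝ 1 γ)
    (hloop : γ 0 = γ 1) : circulation (gradient Φ) γ = 0 := by
  rw [circulation_gradient_eq_sub hΦ hγ, hloop, sub_self]

/-! ### (TF), integrated: torque-free -/

/-- The transport potential `Φ_U` of a `C²` field is `C¹`. [folklore] -/
theorem contDiff_transportPotential (α : ℝ) {U : EuclideanSpace ℝ (Fin 3) → EuclideanSpace ℝ (Fin 3)} (hU : ContDiff ℝ 2 U) :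
    ContDiff ℝ 1 (fun z : EuclideanSpace ℝ (Fin 3) => (1 / 2 : ℝ) * ⟪z, U z⟫_ℝ
        - α * ⟪cross (EuclideanSpace.single 2 1) z, U z⟫_ℝ + (1 / 2 : ℝ) * ‖U z‖ ^ 2) := by
  have hU1 : ContDiff ℝ 1 U := hU.of_le one_le_two
  have h1 : ContDiff ℝ 1 (fun z : EuclideanSpace ℝ (Fin 3) => ⟪z, U z⟫_ℝ) := contDiff_id.inner ℝ hU1
  have h2 : ContDiff ℝ 1 (fun z : EuclideanSpace ℝ (Fin 3) => ⟪cross (EuclideanSpace.single 2 1) z, U z⟫_ℝ) :=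
    (crossCLM (EuclideanSpace.single 2 1)).contDiff.inner ℝ hU1
  have h3 : ContDiff ℝ 1 (fun z : EuclideanSpace ℝ (Fin 3) => ‖U z‖ ^ 2) := hU1.norm_sq ℝ
  exact ((contDiff_const.mul h1).sub (contDiff_const.mul h2)).add (contDiff_const.mul h3)

/-- **(TF), integrated form — TORQUE-FREE** (F6 memo §2).  Let `U : EuclideanSpace ℝ (Fin 3) → EuclideanSpace ℝ (Fin 3)` be `C²` and divergence-free with
`curl U = 0` on an open set `Ω`.  Then the circulation of the profile operator `E_α(U)` around EVERY closed `C¹` loop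
inside `Ω` vanishes: `∮_γ E_α(U)·dl = 0` — whether or not `γ` links vorticity outside `Ω` (the potential `Φ_U` is
single-valued). [folklore] -/
theorem circulation_lerayOp_eq_zero_of_irrotational (α : ℝ) {U : EuclideanSpace ℝ (Fin 3) → EuclideanSpace ℝ (Fin 3)} (hU : ContDiff ℝ 2 U)
    (hdiv : VectorCalculus.IsDivFree U) {Ω : Set (EuclideanSpace ℝ (Fin 3))} (hΩ : IsOpen Ω) (hcurl : ∀ z ∈ Ω, curl U z = 0)
    {γ : ℝ → EuclideanSpace ℝ (Fin 3)} (hγ : ContDiff ℝ 1 γ) (hloop : γ 0 = γ 1) (hγΩ : ∀ s, γ s ∈ Ω) :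
    circulation (fun y => α • (cross (EuclideanSpace.single 2 1) (U y) - fderiv ℝ U y (cross (EuclideanSpace.single 2 1) y))
      + (1 / 2 : ℝ) • U y + (1 / 2 : ℝ) • fderiv ℝ U y y - (Δ U) y + fderiv ℝ U y (U y)) γ = 0 := by
  have heq : ∀ s, (fun y => α • (cross (EuclideanSpace.single 2 1) (U y) - fderiv ℝ U y (cross (EuclideanSpace.single 2 1) y))
      + (1 / 2 : ℝ) • U y + (1 / 2 : ℝ) • fderiv ℝ U y y - (Δ U) y + fderiv ℝ U y (U y)) (γ s)
      = gradient (fun z : EuclideanSpace ℝ (Fin 3) => (1 / 2 : ℝ) * ⟪z, U z⟫_ℝ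
      - α * ⟪cross (EuclideanSpace.single 2 1) z, U z⟫_ℝ + (1 / 2 : ℝ) * ‖U z‖ ^ 2) (γ s) := fun s =>
    lerayOp_eq_gradient_of_irrotational α hU hdiv (eventually_of_mem (hΩ.mem_nhds (hγΩ s)) hcurl)
  have hc : circulation (fun y => α • (cross (EuclideanSpace.single 2 1) (U y) - fderiv ℝ U y (cross (EuclideanSpace.single 2 1) y))
      + (1 / 2 : ℝ) • U y + (1 / 2 : ℝ) • fderiv ℝ U y y - (Δ U) y + fderiv ℝ U y (U y)) γ
      = circulation (gradient (fun z : EuclideanSpace ℝ (Fin 3) => (1 / 2 : ℝ) * ⟪z, U z⟫_ℝ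
      - α * ⟪cross (EuclideanSpace.single 2 1) z, U z⟫_ℝ + (1 / 2 : ℝ) * ‖U z‖ ^ 2)) γ := by
    unfold circulation
    refine intervalIntegral.integral_congr (fun s _ => ?_)
    simp only [heq s]
  rw [hc]
  exact circulation_gradient_loop_eq_zero (contDiff_transportPotential α hU) hγ hloop

/-- **Torque-free on the wall circles** `∂D_R(s)` of the torque budget: for `U` as above and any planar circle
`circleLoop c R e₁ e₂ ⊂ Ω`, `∮ E_α(U)·dl = 0` («`Circ[ũ](s,R) = 0` for every circle outside the core», F6 memo §2). [folklore] -/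
theorem circulation_lerayOp_circleLoop_eq_zero (α : ℝ) {U : EuclideanSpace ℝ (Fin 3) → EuclideanSpace ℝ (Fin 3)} (hU : ContDiff ℝ 2 U)
    (hdiv : VectorCalculus.IsDivFree U) {Ω : Set (EuclideanSpace ℝ (Fin 3))} (hΩ : IsOpen Ω) (hcurl : ∀ z ∈ Ω, curl U z = 0)
    (c e₁ e₂ : EuclideanSpace ℝ (Fin 3)) (R : ℝ) (hcirc : ∀ s, circleLoop c R e₁ e₂ s ∈ Ω) :
    circulation (fun y => α • (cross (EuclideanSpace.single 2 1) (U y) - fderiv ℝ U y (cross (EuclideanSpace.single 2 1) y))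
      + (1 / 2 : ℝ) • U y + (1 / 2 : ℝ) • fderiv ℝ U y y - (Δ U) y + fderiv ℝ U y (U y))
      (circleLoop c R e₁ e₂) = 0 :=
  circulation_lerayOp_eq_zero_of_irrotational α hU hdiv hΩ hcurl (contDiff_circleLoop c R e₁ e₂)
    (isC1Loop_circleLoop c R e₁ e₂).apply_zero_eq_apply_one hcirc

/-- The profile operator of a `C³` field is `C¹` (one derivative for `DU`, two for `ΔU`). [folklore] -/
theorem contDiff_lerayOp (α : ℝ) {U : EuclideanSpace ℝ (Fin 3) → EuclideanSpace ℝ (Fin 3)} (hU : ContDiff ℝ 3 U) :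
    ContDiff ℝ 1 (fun y => α • (cross (EuclideanSpace.single 2 1) (U y) - fderiv ℝ U y (cross (EuclideanSpace.single 2 1) y))
      + (1 / 2 : ℝ) • U y + (1 / 2 : ℝ) • fderiv ℝ U y y - (Δ U) y + fderiv ℝ U y (U y)) := by
  have hU1 : ContDiff ℝ 1 U := hU.of_le (by norm_num)
  have hD : ContDiff ℝ 1 (fderiv ℝ U) := hU.fderiv_right (m := 1) (by norm_num)
  have hc : ContDiff ℝ 1 (fun y : EuclideanSpace ℝ (Fin 3) => cross (EuclideanSpace.single 2 1) y) :=
    (crossCLM (EuclideanSpace.single 2 1)).contDiff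
  have hcU : ContDiff ℝ 1 (fun y : EuclideanSpace ℝ (Fin 3) => cross (EuclideanSpace.single 2 1) (U y)) :=
    (crossCLM (EuclideanSpace.single 2 1)).contDiff.comp hU1
  have hD1 : ContDiff ℝ 1 (fun y : EuclideanSpace ℝ (Fin 3) => fderiv ℝ U y (cross (EuclideanSpace.single 2 1) y)) :=
    hD.clm_apply hc
  have hD2 : ContDiff ℝ 1 (fun y : EuclideanSpace ℝ (Fin 3) => fderiv ℝ U y y) := hD.clm_apply contDiff_id
  have hD3 : ContDiff ℝ 1 (fun y : EuclideanSpace ℝ (Fin 3) => fderiv ℝ U y (U y)) := hD.clm_apply hU1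
  have hΔ : ContDiff ℝ 1 (Δ U) := contDiff_laplacian (n := 1) (hU.of_le (by norm_num))
  have h := (((((hcU.sub hD1).const_smul α).add (hU1.const_smul (1 / 2 : ℝ))).add
    (hD2.const_smul (1 / 2 : ℝ))).sub hΔ).add hD3
  exact h

/-- By Stokes on the disc (tree `circulation_circleLoop_eq_integral_curl`) the same vanishing reads as: the polar flux
of `curl E_α(U)` through any planar disc inside `Ω` is zero — the left side of the torque budget (TB) receives no
contribution from the irrotational region (`U ∈ C³` so that `E_α(U) ∈ C¹`). [folklore] -/
theorem integral_curl_lerayOp_disc_eq_zero (α : ℝ) {U : EuclideanSpace ℝ (Fin 3) → EuclideanSpace ℝ (Fin 3)} (hU : ContDiff ℝ 3 U)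
    (hdiv : VectorCalculus.IsDivFree U) {Ω : Set (EuclideanSpace ℝ (Fin 3))} (hΩ : IsOpen Ω) (hcurl : ∀ z ∈ Ω, curl U z = 0)
    (c e₁ e₂ : EuclideanSpace ℝ (Fin 3)) (R : ℝ) (hcirc : ∀ s, circleLoop c R e₁ e₂ s ∈ Ω) :
    ∫ ρ in (0 : ℝ)..R, ∫ θ in (0 : ℝ)..2 * π,
        ρ * ⟪curl (fun y => α • (cross (EuclideanSpace.single 2 1) (U y) - fderiv ℝ U y (cross (EuclideanSpace.single 2 1) y))
      + (1 / 2 : ℝ) • U y + (1 / 2 : ℝ) • fderiv ℝ U y y - (Δ U) y + fderiv ℝ U y (U y))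
          (c + (ρ * cos θ) • e₁ + (ρ * sin θ) • e₂), cross e₁ e₂⟫_ℝ = 0 := by
  rw [← circulation_circleLoop_eq_integral_curl (contDiff_lerayOp α hU) c e₁ e₂ R]
  exact circulation_lerayOp_circleLoop_eq_zero α (hU.of_le (by norm_num)) hdiv hΩ hcurl c e₁ e₂ R hcirc

end TorqueBudget

end Summit.NavierStokesRegularity.NavierStokesRegularity.Theorems
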